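import Summits.CriticalPhenomena.PercolationContinuityZ3.Theorems.PercNearOneGluingNoHeavyLowerTailSahiExchangeableLC
import Mathlib
import HarnessLib
import HarnessLib.Audit.Tags

/-!
# `NoHeavyLowerTail` (crux stmt-CriticalPhenomena-4575), master-family line P1 (gen 18):
# REFUTATION of `ExchangeableLCClosedNIZ` — log-concave exchangeable weights are NOT closed under monotone substitution

Support file (seat `prim-masterthm-p1`, gen 18; `--supports stmt-CriticalPhenomena-4575`), on top of the tree's
`…SahiExchangeableLC` (gen 17: `tripleWeight`, `inducedWt`, `LogConcaveWtNIZ`, the typed conjecture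
`ExchangeableLCClosedNIZ`).  Memo `run/shared/lean/prim/prim-masterthm/FROM-prim-masterthm-p1-g18-UNION-CONDITIONED.md` §3.

THE WITNESS (four coordinates).  Ground set `{0,1,2,3}`; the monotone Boolean function
`u x = [{0,1,2} ⊆ x] ∨ ([3 ∈ x] ∧ [x ∩ {0,1,2} ≠ ∅])` (up-set `↑{0,1,2} ∪ ↑{0,3} ∪ ↑{1,3} ∪ ↑{2,3}`); coordinates
`0,1,2` carry the PURE weight `δ₁ = (0,1,0,0)` (they are tripartitioned among `x, y, z`), coordinate `3` carries the
i.i.d. weight `(q³, q²p, qp², p³)` with `p = 1/10`, i.e. `(729, 81, 9, 1)` — both are log-concave without internal zeros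
(`w₀w₂ ≤ w₁²`, `w₁w₃ ≤ w₂²`, `w₀w₃ ≤ w₁w₂`, with equality for the i.i.d. weight).  The induced pattern weights are
`(N₀, N₁, N₂, N₃) = (18954, 7698, 342, 6)` (kernel evaluation, `decide`), and
`3·N₁·N₃ = 138564 > 116964 = N₂²`: the second ULC inequality FAILS, so `ExchangeableLCClosedNIZ` is false
(`not_exchangeableLCClosedNIZ`).  In probabilistic terms: with `(x,y,z)` a uniform ordered tripartition of `{0,1,2}`
extended by three independent `Bernoulli(p)` bits at coordinate `3`,
`P(x,y,z ∈ u)·P(z ∈ u) − P(x,z ∈ u)·P(y,z ∈ u) = 6p³(1 − 6p)/729 > 0` for every `p < 1/6` — conditioning on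
`y ∈ u` excludes the configuration "`z ⊇ {0,1,2}`" that kills `x`, while (the i.i.d. coordinate being free) `y`'s
success costs `x` nothing on coordinate `3`.  With all four coordinates pure the same `u` is harmless (then at most
one cell can own coordinate `3`).

CONSEQUENCES (memo §3).  (i) LC-gen is dead: the tripartition ULC lemma (`SahiTripartition.UnateTripartitionULC`,
still census-true through 6 points) is a property of the VERTEX weights `δ₁, δ₂` (every coordinate dealt to exactly one
or exactly two cells), not of log-concavity; equivalently the polynomial ("real monotone `m`") form of Half A is false
(`m = 1_{≠∅} + w·1_{= B}` on 3 points, `w > 5`).  (ii) The composition-closure argument for `LCExmaxNIZ` via LC-gen is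
gone; `LCExmaxNIZ 3` itself survives the same steep weights (all 2022 three-petal labelings of `2⁴` × weights
`{δ₁, δ₂, iid(½), iid(1/10)↑↓, iid(¼)↑↓}⁴`: 4.85·10⁶ exact tests, 0 failures).
HONEST FRAMING: a kernel refutation of a typed conjecture of this line; nothing else changes status. [this work]
-/

namespace Summit.CriticalPhenomena.PercolationContinuityZ3.Theorems

namespace SahiPivotFamily

open Finset

/-! ### 1. Induced weights with natural-number weights are natural numbers -/

/-- The induced pattern weight computed in `ℕ` for `ℕ`-valued coordinate weights (same triple sum as `inducedWt`).
[this work] -/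
def inducedWtNat (S : Finset ℕ) (wn : ℕ → ℕ → ℕ) (u : Finset ℕ → Bool) (c : ℕ) : ℕ :=
  ∑ x ∈ S.powerset, ∑ y ∈ S.powerset, ∑ z ∈ S.powerset,
    if (u x).toNat + (u y).toNat + (u z).toNat = c then
      ∏ j ∈ S, wn j ((if j ∈ x then 1 else 0) + (if j ∈ y then 1 else 0) + (if j ∈ z then 1 else 0))
    else 0

/-- `inducedWt` at the real cast of `ℕ`-valued weights is the cast of `inducedWtNat`. [this work] -/
theorem inducedWt_natCast (S : Finset ℕ) (wn : ℕ → ℕ → ℕ) (u : Finset ℕ → Bool) (c : ℕ) :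
    inducedWt S (fun j i => (wn j i : ℝ)) u c = (inducedWtNat S wn u c : ℝ) := by
  unfold inducedWt inducedWtNat tripleWeight
  push_cast
  refine sum_congr rfl fun x _ => sum_congr rfl fun y _ => sum_congr rfl fun z _ => ?_
  split_ifs <;> simp

/-! ### 2. The witness -/

/-- The weights of the witness, in `ℕ`: coordinate `3` carries `(729, 81, 9, 1)` (i.i.d. bits with `p = 1/10`, scaled
by `1000`), every other coordinate the pure weight `δ₁ = (0,1,0,0)`. [this work] -/
def cexWtNat : ℕ → ℕ → ℕ := fun j c =>
  if j = 3 then (if c = 0 then 729 else if c = 1 then 81 else if c = 2 then 9 else if c = 3 then 1 else 0)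
  else (if c = 1 then 1 else 0)

/-- The weights of the witness as real numbers. [this work] -/
def cexWt : ℕ → ℕ → ℝ := fun j c => (cexWtNat j c : ℝ)

/-- The monotone test function of the witness: `u x = [{0,1,2} ⊆ x] ∨ ([3 ∈ x] ∧ [x meets {0,1,2}])`. [this work] -/
def cexU : Finset ℕ → Bool := fun x =>
  (decide (0 ∈ x) && decide (1 ∈ x) && decide (2 ∈ x)) ||
    (decide (3 ∈ x) && (decide (0 ∈ x) || decide (1 ∈ x) || decide (2 ∈ x)))

/-- `cexU` is monotone. [this work] -/
theorem monotone_cexU : Monotone cexU := by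
  intro x y hxy
  rw [Bool.le_iff_imp]
  simp only [cexU, Bool.or_eq_true, Bool.and_eq_true, decide_eq_true_eq]
  rintro (⟨⟨h0, h1⟩, h2⟩ | ⟨h3, (h0 | h1) | h2⟩)
  · exact Or.inl ⟨⟨hxy h0, hxy h1⟩, hxy h2⟩
  · exact Or.inr ⟨hxy h3, Or.inl (Or.inl (hxy h0))⟩
  · exact Or.inr ⟨hxy h3, Or.inl (Or.inr (hxy h1))⟩
  · exact Or.inr ⟨hxy h3, Or.inr (hxy h2)⟩

/-- Every coordinate weight of the witness is log-concave without internal zeros (for the i.i.d. coordinate all three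
conditions hold with equality: `729·9 = 81²`, `81·1 = 9²`, `729·1 = 81·9`). [this work] -/
theorem logConcaveWtNIZ_cexWt (j : ℕ) : LogConcaveWtNIZ (cexWt j) := by
  unfold LogConcaveWtNIZ LogConcaveWt cexWt cexWtNat
  by_cases hj : j = 3
  · subst hj
    refine ⟨⟨fun c => Nat.cast_nonneg _, ?_, ?_⟩, ?_⟩ <;> norm_num
  · simp only [hj, if_false]
    refine ⟨⟨fun c => Nat.cast_nonneg _, ?_, ?_⟩, ?_⟩ <;> norm_num

/-! ### 3. The induced weights of the witness (kernel evaluation) -/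

/-- `N₀ = 18954`. [this work] -/
theorem inducedWtNat_cex_zero : inducedWtNat {0, 1, 2, 3} cexWtNat cexU 0 = 18954 := by decide +kernel

/-- `N₁ = 7698`. [this work] -/
theorem inducedWtNat_cex_one : inducedWtNat {0, 1, 2, 3} cexWtNat cexU 1 = 7698 := by decide +kernel

/-- `N₂ = 342`. [this work] -/
theorem inducedWtNat_cex_two : inducedWtNat {0, 1, 2, 3} cexWtNat cexU 2 = 342 := by decide +kernel

/-- `N₃ = 6`. [this work] -/
theorem inducedWtNat_cex_three : inducedWtNat {0, 1, 2, 3} cexWtNat cexU 3 = 6 := by decide +kernel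

/-- The real induced weights of the witness: `(N₁, N₂, N₃) = (7698, 342, 6)`. [this work] -/
theorem inducedWt_cex :
    inducedWt {0, 1, 2, 3} cexWt cexU 1 = 7698 ∧ inducedWt {0, 1, 2, 3} cexWt cexU 2 = 342 ∧
      inducedWt {0, 1, 2, 3} cexWt cexU 3 = 6 := by
  have h1 := inducedWt_natCast {0, 1, 2, 3} cexWtNat cexU 1
  have h2 := inducedWt_natCast {0, 1, 2, 3} cexWtNat cexU 2
  have h3 := inducedWt_natCast {0, 1, 2, 3} cexWtNat cexU 3
  rw [inducedWtNat_cex_one] at h1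
  rw [inducedWtNat_cex_two] at h2
  rw [inducedWtNat_cex_three] at h3
  refine ⟨?_, ?_, ?_⟩
  · exact_mod_cast h1
  · exact_mod_cast h2
  · exact_mod_cast h3

/-! ### 4. The refutation -/

/-- **REFUTATION: `ExchangeableLCClosedNIZ` is false** — at the witness `3·N₁·N₃ = 138564 > 116964 = N₂²`: the events
`x ∈ u`, `y ∈ u` are POSITIVELY correlated given `z ∈ u` although every coordinate weight is log-concave without internal
zeros.  (The too-weak form `ExchangeableLCClosed` was refuted in the tree's `not_exchangeableLCClosed`; this is the
intended form.) [this work] -/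
theorem not_exchangeableLCClosedNIZ : ¬ ExchangeableLCClosedNIZ := by
  intro h
  have := (h {0, 1, 2, 3} cexU cexWt monotone_cexU (fun j _ => logConcaveWtNIZ_cexWt j)).2
  rw [inducedWt_cex.1, inducedWt_cex.2.1, inducedWt_cex.2.2] at this
  norm_num at this

end SahiPivotFamily

end Summit.CriticalPhenomena.PercolationContinuityZ3.Theorems
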